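import Summits.BirchSwinnertonDyer.BirchSwinnertonDyer.Theorems.ByReductionTypeAtTwoRankOneAtTwoOffBigImageOddLocalEngineRamifiedSupply
import HarnessLib

/-!
# Route `ByReductionTypeAtTwo`, crux `RankOneAtTwoOffBigImageOddLocal` (stmt-BirchSwinnertonDyer-23716), line
# `refined_kolyvagin_tamagawa_shift_at_two` — ENGINE PORT `c₀ ↦ h₀` (regular element), §J the regular involution `[[1,1],[0,−1]]` and the COMPLETE regular supply

Lead prover `prover-cruxlead-stmt-BirchSwinnertonDyer-23716-g0` (2026-08-28), landing the crux-plan g6 ENGINE QUARRY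
`Cruxes/RankOneAtTwoOffBigImageOddLocal/RefinedKolyvaginEngineG6.lean` (planner `cruxplan-…-23716-refined-kolyvag-9ff2fe475f-g6`, v10, ≈2800 lines,
rc 0 / 0 sorry; `Cruxes/` files are not importable, so the lead COPIES the proofs into `Theorems/` — card «LEAD QUICKSTART (g6)» Q2 #3 / Q4) as
`--supports stmt-BirchSwinnertonDyer-23716` helpers, continuing `…Engine{Dictionary,Parity,Cyclotomic,CyclotomicBasis,GoursatLift,Chebotarev,RegularSupply,
RegularLift}.lean`.  The engine port = kernel-closable item #3 of the pen's order (PEN-PICK-23716 ADD-4): Kolyvagin primes whose Frobenius is a REGULAR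
element `h₀` (det `−1`, trace `0`, odd mod `2`; LOSSLESS local Kummer maps by R1/LKL) instead of complex conjugation `c₀` (which loses the top bit at
`Δ > 0`, residual 24883), with McCallum's exact local orders — the supply the line's filtered stubs `…WithOn Φ_reg Ω` consume (card #7
`regular-frobenius-kolyvagin-primes-pos-disc`).  THIS FILE: §J — the regular involution `reg b` / `regAut b` of a `ZMod q`-module with basis `b` (`reg_reg`, `det_reg = −1`, fixed vectors `eq_smul_basis_zero_of_reg_eq`, `exists_eq_add_reg_of_reg_eq`, `basis_one_add_reg`), `nonempty_basis_geomTorsion` (a `ZMod m`-basis of `E[m]`), and the COMPLETE REGULAR SUPPLY `exists_regular_galoisElement_of_supply / _of_doorAdmissible / _of_heegner`: on the crux's habitat some `h₀ = c₀ · res ρ₀` acts on `E[2^{M+1}]` as the regular involution (defs `reg`, `regAut`, reviewed).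

Statements and proofs are the quarry's VERBATIM (namespace moved to `…Theorems.OffBigImageOddLocalAtTwo.Engine`).  Nothing here proves the crux,
`BSDp W 2`, BSD or the summit; no registered stub is discharged (engine inputs only).  BSD is not proved.

Refs: [GrossLMS1991] §3 (3.1)–(3.3), §9; [McCallumLMS1991] §3 (Cor. 3.2, Prop. 3.1), §5; [SilvermanAEC2009] III.7–III.8, VII–VIII; Serre (1972) §5.3.
-/

set_option linter.dupNamespace false -- tree convention: `Summit.BirchSwinnertonDyer.BirchSwinnertonDyer.Theorems` (summit = sub-problem)
set_option autoImplicit false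

noncomputable section

namespace Summit.BirchSwinnertonDyer.BirchSwinnertonDyer.Theorems.OffBigImageOddLocalAtTwo.Engine

/-! ## §J  The regular involution `[[1,1],[0,-1]]`: R1 / LKL (lossless), `det = -1`, and the COMPLETE regular supply
for the skeleton (E1 + the inputs `hsq`, `hP1`, `hker` of §H and `hμ` of §F) -/

section RegularInvolution

variable {q : ℕ} {T : Type*} [AddCommGroup T] [Module (ZMod q) T] (b : Module.Basis (Fin 2) (ZMod q) T)

/-- The REGULAR INVOLUTION of a rank-`2` free `ZMod q`-module in the basis `b` — matrix `[[1,1],[0,-1]]`: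
`x•b₀ + y•b₁ ↦ (x + y)•b₀ - y•b₁` (`regR` of the one-door filter; a transvection times `diag(1,-1)`). [folklore] -/
def reg (X : T) : T := (b.repr X 0 + b.repr X 1) • b 0 - b.repr X 1 • b 1

/-- First coordinate of `reg b X`: `x₀ + x₁`. [folklore] -/
theorem repr_reg_zero (X : T) : b.repr (reg b X) 0 = b.repr X 0 + b.repr X 1 := by
  simp [reg]

/-- Second coordinate of `reg b X`: `−x₁`. [folklore] -/
theorem repr_reg_one (X : T) : b.repr (reg b X) 1 = - b.repr X 1 := by
  simp [reg]

/-- `reg` is an involution. [folklore] -/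
theorem reg_reg (X : T) : reg b (reg b X) = X := by
  refine b.ext_elem fun i ↦ ?_
  fin_cases i
  · simp [repr_reg_zero, repr_reg_one]
  · simp [repr_reg_one]

/-- `reg b` is additive. [folklore] -/
theorem reg_add (X Y : T) : reg b (X + Y) = reg b X + reg b Y := by
  simp only [reg, map_add, Finsupp.add_apply, add_smul]
  abel

/-- `reg` as an additive automorphism (an element of `AddAut T = Aut(E[q])`, the target of `ρ̄_{E,q}`). [folklore] -/
def regAut : AddAut T where
  toFun := reg b
  invFun := reg b
  left_inv := reg_reg b
  right_inv := reg_reg b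
  map_add' := reg_add b

/-- `regAut b` acts as `reg b`. [folklore] -/
@[simp] theorem regAut_apply (X : T) : regAut b X = reg b X := rfl

/-- `reg b` fixes `b 0`. [folklore] -/
theorem reg_basis_zero : reg b (b 0) = b 0 := by
  refine b.ext_elem fun i ↦ ?_
  fin_cases i <;> simp [repr_reg_zero, repr_reg_one]

/-- `reg b (b 1) = b 0 − b 1`. [folklore] -/
theorem reg_basis_one : reg b (b 1) = b 0 - b 1 := by
  refine b.ext_elem fun i ↦ ?_
  fin_cases i <;> simp [repr_reg_zero, repr_reg_one]

/-- **`det [[1,1],[0,-1]] = -1`** in the form consumed by §E `smul_eq_inv_of_det_repr_eq_neg_one`. [folklore] -/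
theorem det_reg :
    b.repr (reg b (b 0)) 0 * b.repr (reg b (b 1)) 1 - b.repr (reg b (b 1)) 0 * b.repr (reg b (b 0)) 1 = -1 := by
  simp [repr_reg_zero, repr_reg_one]

/-- A `reg`-fixed vector has vanishing second coordinate (`(x + y, -y) = (x, y) ⟹ y = 0`; NB over `ZMod 2^M` the
second coordinate alone, `-y = y`, would not suffice). [folklore] -/
theorem repr_one_eq_zero_of_reg_eq {X : T} (h : reg b X = X) : b.repr X 1 = 0 := by
  have h0 := congrArg (fun Z ↦ b.repr Z 0) h
  simpa [repr_reg_zero] using h0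

/-- A vector fixed by the regular involution is a multiple of `b 0`. [folklore] -/
theorem eq_smul_basis_zero_of_reg_eq {X : T} (h : reg b X = X) : X = b.repr X 0 • b 0 := by
  have h1 := repr_one_eq_zero_of_reg_eq b h
  refine b.ext_elem fun i ↦ ?_
  fin_cases i <;> simp [h1]

/-- **R1 / LKL — the regular involution is LOSSLESS at every level**: `ker(reg - 1) = im(reg + 1)` on the `c`-torsion
of `T` for every integer `c` (in particular `c = 2^e`, `e ≤ M`): a fixed `X = x•b₀` with `cX = 0` is `Y + reg Y` for
`Y = x•b₁`, and `cY = 0`.  This is the hypothesis `hker` of §H `exists_galoisElement_regular_rat`. [folklore] -/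
theorem exists_eq_add_reg_of_reg_eq {c : ℤ} {X : T} (hc : c • X = 0) (h : reg b X = X) :
    ∃ Y : T, c • Y = 0 ∧ X = Y + reg b Y := by
  have hX := eq_smul_basis_zero_of_reg_eq b h
  set x := b.repr X 0 with hx
  have hcx : ((c : ZMod q) * x) = 0 := by
    have h0 := congrArg (fun Z ↦ b.repr Z 0) hc
    rw [hX, ← Int.cast_smul_eq_zsmul (ZMod q), smul_smul] at h0
    simpa [Finsupp.single_apply] using h0
  refine ⟨x • b 1, ?_, ?_⟩
  · rw [← Int.cast_smul_eq_zsmul (ZMod q), smul_smul, hcx, zero_smul]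
  · rw [hX]
    refine b.ext_elem fun i ↦ ?_
    fin_cases i <;> simp [reg]

/-- `b₁ + reg b₁ = b₀`. [folklore] -/
theorem basis_one_add_reg : b 1 + reg b (b 1) = b 0 := by
  rw [reg_basis_one]; abel

/-- An integer multiple `k • b i` of a basis vector vanishes only if `k = 0` in `ZMod q`. [folklore] -/
theorem zsmul_basis_ne_zero {k : ℤ} (hk : (k : ZMod q) ≠ 0) (i : Fin 2) : k • b i ≠ 0 := by
  intro h
  apply hk
  have h0 := congrArg (fun Z ↦ b.repr Z i) h
  rw [← Int.cast_smul_eq_zsmul (ZMod q)] at h0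
  simpa [Finsupp.single_apply] using h0

/-- `2^n ≠ 0` in `ZMod 2^{n+1}`. [folklore] -/
theorem two_pow_ne_zero_zmod (n : ℕ) : (((2 : ℤ) ^ n : ℤ) : ZMod (2 ^ (n + 1))) ≠ 0 := by
  haveI : NeZero (2 ^ (n + 1)) := ⟨pow_ne_zero _ two_ne_zero⟩
  rw [Ne, ZMod.intCast_zmod_eq_zero_iff_dvd]
  intro h
  have h' : 2 ^ (n + 1) ∣ 2 ^ n := by exact_mod_cast h
  rw [Nat.pow_dvd_pow_iff_le_right (by norm_num)] at h'
  omega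

end RegularInvolution

/-! ### A `ZMod m`-basis of `E(ℚ̄)[m]` (Silverman AEC III.6.4(b), tree `nonempty_geomTorsion_addEquiv_prod`) -/

section TorsionBasis

open WeierstrassCurve
open Literature.NumberTheory.GaloisRepresentations Literature.NumberTheory.EllipticCurves Literature.NumberTheory

/-- **`E(ℚ̄)[m]` is free of rank `2` over `ℤ/m`**: a `ZMod m`-basis indexed by `Fin 2`, for the `ZMod m`-module structure
`AddSubgroup.torsionBy.zmodModule` the tree puts on `geomTorsion` (via `letI`).  From the tree's `E[m] ≃+ ℤ/m × ℤ/m`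
(`nonempty_geomTorsion_addEquiv_prod`, AEC III.6.4(b)) made `ZMod m`-linear (`AddMonoidHom.toZModLinearMap`).
[cite: SilvermanAEC2009, Cor. III.6.4(b)] -/
theorem nonempty_basis_geomTorsion (W : WeierstrassCurve ℚ) [W.IsElliptic] (m : ℕ) [NeZero m] :
    letI : Module (ZMod m) (geomTorsion W (m : ℤ)) := AddSubgroup.torsionBy.zmodModule
    Nonempty (Module.Basis (Fin 2) (ZMod m) (geomTorsion W (m : ℤ))) := by
  letI : Module (ZMod m) (geomTorsion W (m : ℤ)) := AddSubgroup.torsionBy.zmodModule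
  obtain ⟨θ⟩ := W.nonempty_geomTorsion_addEquiv_prod (m := m) (by exact_mod_cast NeZero.ne m)
  let L : geomTorsion W (m : ℤ) ≃ₗ[ZMod m] (ZMod m × ZMod m) :=
    { AddMonoidHom.toZModLinearMap m θ.toAddMonoidHom with
      invFun := θ.symm
      left_inv := θ.left_inv
      right_inv := θ.right_inv }
  exact ⟨(Module.Basis.finTwoProd (ZMod m)).map L.symm⟩

end TorsionBasis

/-! ### The complete regular supply for the skeleton -/

section RegularSupplyJ

open WeierstrassCurve NumberField IsDedekindDomain Field
open Literature.NumberTheory.GaloisRepresentations Literature.NumberTheory.EllipticCurves Literature.NumberTheory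
open Summit.BirchSwinnertonDyer.BirchSwinnertonDyer.Theorems

universe u

variable {W : WeierstrassCurve ℚ} {K : Type u} [Field K] [NumberField K]

/-- **THE REGULAR ELEMENT FOR THE SKELETON (E1 + the inputs of E2/E3, PROVED).**  For `K` imaginary quadratic with `d_K`
door-admissible for `E`, `ρ̄_{E,2^{n+1}}` surjective and ANY `c₀ ∈ Γ_ℚ` (the engine's complex conjugation), there are `ρ₀ ∈ Γ_K` and
`P ∈ E[2^{n+1}]` such that `h₀ := c₀ · res ρ₀` (i) is an involution on `E(ℚ̄)[2^{n+1}]` (`hsq`), (ii) has `2^n (P + h₀P) ≠ 0` (`hP1`,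
`M = n+1`), (iii) is LOSSLESS: `ker(h₀ - 1) = im(h₀ + 1)` on every `E[2^e]` (`hker`, R1/LKL), and (iv) every `σ ∈ Γ_ℚ` acting on
`E[2^{n+1}]` as `h₀` INVERTS `μ_{2^{n+1}}` (`hμ` for the final `c₀ · res(ρ₀ n m)` of §H, via §E: `det [[1,1],[0,-1]] = -1`).
Feeds `exists_galoisElement_regular_rat` (§H) and Steps C–H (§F) with NO further arithmetic input. [folklore] -/
theorem exists_regular_galoisElement_of_supply [W.IsElliptic] (n : ℕ) (c₀ : absoluteGaloisGroup ℚ)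
    (hsup : ∀ A : AddAut (geomTorsion W ((2 ^ (n + 1) : ℕ) : ℤ)),
      ∃ ρ₀ : absoluteGaloisGroup K, ∀ P : geomTorsion W ((2 ^ (n + 1) : ℕ) : ℤ),
        (c₀ * absGaloisRestrict ℚ K ρ₀) • P = A P) :
    ∃ ρ₀ : absoluteGaloisGroup K, ∃ P : geomTorsion W ((2 ^ (n + 1) : ℕ) : ℤ),
      (∀ X : geomTorsion W ((2 ^ (n + 1) : ℕ) : ℤ),
          (c₀ * absGaloisRestrict ℚ K ρ₀) • (c₀ * absGaloisRestrict ℚ K ρ₀) • X = X) ∧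
      ((2 : ℤ) ^ n • (P + (c₀ * absGaloisRestrict ℚ K ρ₀) • P) ≠ 0) ∧
      (∀ (e : ℕ) (X : geomTorsion W ((2 ^ (n + 1) : ℕ) : ℤ)), (2 : ℤ) ^ e • X = 0 →
          (c₀ * absGaloisRestrict ℚ K ρ₀) • X = X →
          ∃ Y : geomTorsion W ((2 ^ (n + 1) : ℕ) : ℤ),
            (2 : ℤ) ^ e • Y = 0 ∧ X = Y + (c₀ * absGaloisRestrict ℚ K ρ₀) • Y) ∧
      (∀ σ : absoluteGaloisGroup ℚ,
          (∀ X : geomTorsion W ((2 ^ (n + 1) : ℕ) : ℤ), σ • X = (c₀ * absGaloisRestrict ℚ K ρ₀) • X) →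
          ∀ ζ : AlgebraicClosure ℚ, ζ ^ (2 ^ (n + 1)) = 1 → σ • ζ = ζ⁻¹) := by
  letI : Module (ZMod (2 ^ (n + 1))) (geomTorsion W ((2 ^ (n + 1) : ℕ) : ℤ)) :=
    AddSubgroup.torsionBy.zmodModule
  haveI : NeZero (2 ^ (n + 1)) := ⟨pow_ne_zero _ two_ne_zero⟩
  obtain ⟨b⟩ := nonempty_basis_geomTorsion W (2 ^ (n + 1))
  obtain ⟨ρ₀, hρ₀⟩ := hsup (regAut b)
  simp only [regAut_apply] at hρ₀
  refine ⟨ρ₀, b 1, fun X ↦ ?_, ?_, fun e X heX hfix ↦ ?_, fun σ hσ ζ hζ ↦ ?_⟩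
  · rw [hρ₀, hρ₀, reg_reg]
  · rw [hρ₀, basis_one_add_reg]
    exact zsmul_basis_ne_zero b (two_pow_ne_zero_zmod n) 0
  · rw [hρ₀] at hfix
    obtain ⟨Y, hY, hXY⟩ := exists_eq_add_reg_of_reg_eq b heX hfix
    exact ⟨Y, hY, by rw [hρ₀]; exact hXY⟩
  · refine smul_eq_inv_of_det_repr_eq_neg_one W Nat.prime_two n b ?_ ζ hζ
    rw [hσ, hσ, hρ₀, hρ₀]
    exact det_reg b

/-- **THE REGULAR ELEMENT FOR THE DOOR-LAW STUBS** (binder `DoorAdmissible W d_K`): `exists_regular_galoisElement_of_supply` + §I′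
`exists_mul_absGaloisRestrict_smul_eq_addAut_of_doorAdmissible`. [folklore] -/
theorem exists_regular_galoisElement_of_doorAdmissible [W.IsElliptic] [W.IsGloballyMinimal]
    (hK : IsImaginaryQuadratic K) (hD : RankOneAtTwoOneDoor.DoorAdmissible W (NumberField.discr K)) (n : ℕ)
    (hsurj : W.HasSurjectiveModNGaloisRep ((2 ^ (n + 1) : ℕ) : ℤ)) (c₀ : absoluteGaloisGroup ℚ) :
    ∃ ρ₀ : absoluteGaloisGroup K, ∃ P : geomTorsion W ((2 ^ (n + 1) : ℕ) : ℤ),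
      (∀ X : geomTorsion W ((2 ^ (n + 1) : ℕ) : ℤ),
          (c₀ * absGaloisRestrict ℚ K ρ₀) • (c₀ * absGaloisRestrict ℚ K ρ₀) • X = X) ∧
      ((2 : ℤ) ^ n • (P + (c₀ * absGaloisRestrict ℚ K ρ₀) • P) ≠ 0) ∧
      (∀ (e : ℕ) (X : geomTorsion W ((2 ^ (n + 1) : ℕ) : ℤ)), (2 : ℤ) ^ e • X = 0 →
          (c₀ * absGaloisRestrict ℚ K ρ₀) • X = X →
          ∃ Y : geomTorsion W ((2 ^ (n + 1) : ℕ) : ℤ),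
            (2 : ℤ) ^ e • Y = 0 ∧ X = Y + (c₀ * absGaloisRestrict ℚ K ρ₀) • Y) ∧
      (∀ σ : absoluteGaloisGroup ℚ,
          (∀ X : geomTorsion W ((2 ^ (n + 1) : ℕ) : ℤ), σ • X = (c₀ * absGaloisRestrict ℚ K ρ₀) • X) →
          ∀ ζ : AlgebraicClosure ℚ, ζ ^ (2 ^ (n + 1)) = 1 → σ • ζ = ζ⁻¹) :=
  exists_regular_galoisElement_of_supply n c₀ fun A ↦
    exists_mul_absGaloisRestrict_smul_eq_addAut_of_doorAdmissible hK hD hsurj c₀ A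

/-- **THE REGULAR ELEMENT FOR THE BIG-IMAGE STUBS S3/S4/S5** (binders `Odd d_K`, `SatisfiesHeegnerHypothesis N_E K`):
`exists_regular_galoisElement_of_supply` + §I′ `exists_mul_absGaloisRestrict_smul_eq_addAut_of_heegner`. [folklore] -/
theorem exists_regular_galoisElement_of_heegner [W.IsElliptic]
    (hK : IsImaginaryQuadratic K) (hodd : Odd (NumberField.discr K))
    (hH : SatisfiesHeegnerHypothesis (W.conductorNorm ℤ) K) (n : ℕ)
    (hsurj : W.HasSurjectiveModNGaloisRep ((2 ^ (n + 1) : ℕ) : ℤ)) (c₀ : absoluteGaloisGroup ℚ) :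
    ∃ ρ₀ : absoluteGaloisGroup K, ∃ P : geomTorsion W ((2 ^ (n + 1) : ℕ) : ℤ),
      (∀ X : geomTorsion W ((2 ^ (n + 1) : ℕ) : ℤ),
          (c₀ * absGaloisRestrict ℚ K ρ₀) • (c₀ * absGaloisRestrict ℚ K ρ₀) • X = X) ∧
      ((2 : ℤ) ^ n • (P + (c₀ * absGaloisRestrict ℚ K ρ₀) • P) ≠ 0) ∧
      (∀ (e : ℕ) (X : geomTorsion W ((2 ^ (n + 1) : ℕ) : ℤ)), (2 : ℤ) ^ e • X = 0 →
          (c₀ * absGaloisRestrict ℚ K ρ₀) • X = X →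
          ∃ Y : geomTorsion W ((2 ^ (n + 1) : ℕ) : ℤ),
            (2 : ℤ) ^ e • Y = 0 ∧ X = Y + (c₀ * absGaloisRestrict ℚ K ρ₀) • Y) ∧
      (∀ σ : absoluteGaloisGroup ℚ,
          (∀ X : geomTorsion W ((2 ^ (n + 1) : ℕ) : ℤ), σ • X = (c₀ * absGaloisRestrict ℚ K ρ₀) • X) →
          ∀ ζ : AlgebraicClosure ℚ, ζ ^ (2 ^ (n + 1)) = 1 → σ • ζ = ζ⁻¹) :=
  exists_regular_galoisElement_of_supply n c₀ fun A ↦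
    exists_mul_absGaloisRestrict_smul_eq_addAut_of_heegner hK hodd hH hsurj c₀ A

end RegularSupplyJ

end Summit.BirchSwinnertonDyer.BirchSwinnertonDyer.Theorems.OffBigImageOddLocalAtTwo.Engine

end
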